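import Mathlib
import Summits.QuantumAdvantage.QuantumAdvantage.Theses.WhiteBoxWalk
import Summits.QuantumAdvantage.QuantumAdvantage.Theorems.WbwVerifiableLineNoSpeedup.Negative.LoadBearing
import Summits.QuantumAdvantage.QuantumAdvantage.Theorems.WbwVerifiableLineNoSpeedup.Negative.Tightness
import Literature.Computability.QuantumComplexity.SinkOfVerifiableLine
import Literature.Computability.QuantumComplexity.ExactQuantumQuery
import Literature.Computability.QuantumComplexity.SpectralAdversary

/-!
# Skeleton line `cycle-surgery-adversary` for the crux `WhiteBoxWalk.WbwVerifiableLineNoSpeedup`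
(stmt-QuantumAdvantage-2239) — LEAD PROVER'S RESHAPE (prover-line-stmt-QuantumAdvantage-2239-0)

THE CRUX (`Negative.crux_iff`, `Iff.rfl`):
`∃ c > 0, ∀ m T, 2 ≤ m → 1 ≤ T → T + 1 ≤ 2^(m-1) → c · min (T+1) √(2^m) / m ≤ Q_{1/3}(SVL_{m,T})`,
`Q_{1/3}(SVL_{m,T}) = svlQ m T = quantumQueryComplexityOn (1/3) (svlPromise m T) (svlSinkBit m T)`.

THE LINE (idea card `Ideas/cycle-surgery-adversary.md`, planner's card `Lines/cycle-surgery-adversary.md`,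
triage r1-1/2/3 pass): Ambainis's RELATIONAL ADVERSARY (JCSS 2002 Thm 6, average-degree form, constant
`144` of the tree's `SpectralAdversary.lean`) fed with the TWO-ROW CYCLE SURGERY `S' = S * swap(x_k, v)` on
the prefix-pinned long-cycle PERMUTATION family (`hid = min T 2^(m-4)`, `pre = T - hid`). All objects are
`…CycleSurgeryAdversaryDefs.lean`), and the former `stub_surgerySymm` is PROVED and landed together with
the anatomy of a surgery (`…CycleSurgeryAnatomy.lean`: `surgery_tail`, `IsSurgery.anatomy` — for a
surgery inside the family `x'_{k+j} = S^j v` for `1 ≤ j ≤ T - k`, uniformly in the merge and far-split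
cases — and `IsSurgery.symm`).

RESHAPE (same line, same composition idea, lead 2026-08-16): the planner's four stubs
`stub_surgerySymm` (now proved), `stub_relationalAdversary` (kept verbatim), `stub_pairProducts` (kept,
now unconditional: symmetry is a theorem) and `stub_minDegree` ↦ split at the skeleton level into
`stub_partnerFamily` (merge and far-split partners stay in the family; their sink), `stub_goodSetCard`
(the parity count: ≥ 2^(m-3) good partners per cut), `stub_familyNonempty` (both sink parities occur)
and `stub_degrees` (the Finset injection `(k, v) ↦ S * swap(x_k, v)` assembling the min-degree bound
`dstar = hid · 2^m / 8` on both sides, the odd side through `IsSurgery.symm`). Six registered stubs,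
explicit signatures over landed definitions (no `Prop` abbreviations), composition
`WbwVerifiableLineNoSpeedup_of` kernel-checked modulo the stubs (`c = 1/4608`, unchanged arithmetic of
the planner's `cruxShape_of`; `Q ≥ 1` for `m ≤ 9` from the landed `Negative.one_le_svlQ_of_hyps`).

DISPROOF USED (Disproof.lean gen 1 + landed `Negative/{LoadBearing,Tightness,QueryReindex}.lean`):
`_false_without_Tpos` — `1 ≤ T` gives `hid ≥ 1` (a nonempty hidden window; `stub_degrees`) and `Q ≥ 1`;
`_false_without_Tbound` — `T + 1 ≤ 2^(m-1)` is the prefix parity budget of `stub_goodSetCard` and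
`T + 2 ≤ 2^m` in `Q ≥ 1`; `not_groverBranchOnly` / `admissible_const_le_one` — consistent (`c = 1/4608`,
bound `min(hid, √N)`); §6.4 single-input barrier — evaded (many-input relational method); §7
(`SvlAdversarySmallT`) — this line's stubs give it for `16 T ≤ 2^m` and replace `PaddingMonotone` by the
pinned prefix. No landed Negative lemma refutes a stub.
-/

noncomputable section

set_option linter.dupNamespace false

namespace Summit.QuantumAdvantage.QuantumAdvantage.Theorems.WbwVerifiableLineNoSpeedup.CycleSurgery

open Literature.Computability.Cryptography Literature.Computability.QuantumComplexity
  Literature.Computability.Complexity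
open Summit.QuantumAdvantage.QuantumAdvantage.Theses.WhiteBoxWalk (WbwVerifiableLineNoSpeedup)
open Summit.QuantumAdvantage.QuantumAdvantage.Theorems.WbwVerifiableLineNoSpeedup.Negative


open Literature.Computability.Cryptography Literature.Computability.QuantumComplexity

/-! ## §1 The hard instances: prefix-pinned long-cycle permutations, and the surgery relation -/

section Family

variable {m T : ℕ}

/-- The source name `0ᵐ`. -/
def src (m : ℕ) : Fin (2 ^ m) := ⟨0, Nat.two_pow_pos m⟩

/-- The `i`-th point `x_i = S^i(0)` of the orbit of the source under the permutation `S`. -/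
def pt (S : Equiv.Perm (Fin (2 ^ m))) (i : ℕ) : Fin (2 ^ m) := (S ^ i) (src m)

/-- The would-be line `x_0, …, x_T` of `S`. -/
def lineOf (m T : ℕ) (S : Equiv.Perm (Fin (2 ^ m))) (i : Fin (T + 1)) : Fin (2 ^ m) := pt S i.val

/-- The SVL instance of a permutation: S-table `= S`, `V(x, i) = [x = S^i(0)]`. -/
def permInstance (m T : ℕ) (S : Equiv.Perm (Fin (2 ^ m))) : SVLInput m T :=
  svlInput m T S fun x i => decide (x = lineOf m T S i)

/-- The parity of the sink `x_T = S^T(0)` (the function value of the instance of `S`). -/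
def sinkOdd (m T : ℕ) (S : Equiv.Perm (Fin (2 ^ m))) : Bool := decide ((pt S T).val % 2 = 1)

/-- The hidden horizon `hid = min (T, 2^m / 16)`: only the last `hid` steps of the line are
unknown to the solver; surgery happens there. -/
def hid (m T : ℕ) : ℕ := min T (2 ^ (m - 4))

/-- The pinned prefix length `pre = T - hid`: the line starts `0 → 1 → ⋯ → pre`. -/
def pre (m T : ℕ) : ℕ := T - hid m T

/-- The hard family `F(m, T)`: (F1) prefix rows `S(i) = i + 1` for `i < pre` (so `x_i = i` for
`i ≤ pre`); (F2) the line `x_0, …, x_T` is simple; (F3) every point has `S`-period `> hid`. -/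
def InFamily (m T : ℕ) (S : Equiv.Perm (Fin (2 ^ m))) : Prop :=
  (∀ x : Fin (2 ^ m), x.val < pre m T → (S x).val = x.val + 1) ∧
    Function.Injective (lineOf m T S) ∧
      ∀ x : Fin (2 ^ m), ∀ j : ℕ, 0 < j → j ≤ hid m T → (S ^ j) x ≠ x

/-- The cycle surgery relation: `S' = S * swap(x_k, v)` (`S'(x_k) = S(v)`, `S'(v) = S(x_k)`, all
other rows equal) for a hidden cut position `pre ≤ k < T` and a name `v` OFF the line of `S`,
both permutations in the family. -/
def IsSurgery (m T : ℕ) (S S' : Equiv.Perm (Fin (2 ^ m))) : Prop :=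
  InFamily m T S ∧ InFamily m T S' ∧
    ∃ k : ℕ, pre m T ≤ k ∧ k < T ∧ ∃ v : Fin (2 ^ m),
      (∀ i : ℕ, i ≤ T → v ≠ pt S i) ∧ S' = S * Equiv.swap (pt S k) v

open scoped Classical in
/-- `X` = the instances of family members with EVEN sink. -/
def famX (m T : ℕ) : Finset (SVLInput m T) :=
  (Finset.univ.filter fun S : Equiv.Perm (Fin (2 ^ m)) =>
      InFamily m T S ∧ sinkOdd m T S = false).image (permInstance m T)

open scoped Classical in
/-- `Y` = the instances of family members with ODD sink. -/
def famY (m T : ℕ) : Finset (SVLInput m T) :=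
  (Finset.univ.filter fun S : Equiv.Perm (Fin (2 ^ m)) =>
      InFamily m T S ∧ sinkOdd m T S = true).image (permInstance m T)

open scoped Classical in
/-- `R ⊆ X × Y` = the surgery pairs (even sink, odd sink), as pairs of input strings. -/
def rel (m T : ℕ) : Finset (SVLInput m T × SVLInput m T) :=
  (Finset.univ.filter fun SS' : Equiv.Perm (Fin (2 ^ m)) × Equiv.Perm (Fin (2 ^ m)) =>
      IsSurgery m T SS'.1 SS'.2 ∧ sinkOdd m T SS'.1 = false ∧ sinkOdd m T SS'.2 = true).image
    fun SS' => (permInstance m T SS'.1, permInstance m T SS'.2)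

/-! ### Orbit bookkeeping -/

/-- `x_0 = 0ᵐ`. -/
@[simp] theorem pt_zero (S : Equiv.Perm (Fin (2 ^ m))) : pt S 0 = src m := by
  simp [pt]

/-- `x_{i+1} = S x_i`. -/
theorem pt_succ (S : Equiv.Perm (Fin (2 ^ m))) (i : ℕ) : pt S (i + 1) = S (pt S i) := by
  simp [pt, pow_succ', Equiv.Perm.mul_apply]

/-- `x_{i+j} = S^j x_i`. -/
theorem pt_add (S : Equiv.Perm (Fin (2 ^ m))) (i j : ℕ) : pt S (i + j) = (S ^ j) (pt S i) := by
  rw [pt, add_comm, pow_add, Equiv.Perm.mul_apply]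
  rfl

/-- Injectivity of the line, in `ℕ`-indexed form. -/
theorem pt_injOn_of_injective {S : Equiv.Perm (Fin (2 ^ m))}
    (hinj : Function.Injective (lineOf m T S)) {i j : ℕ} (hi : i ≤ T) (hj : j ≤ T)
    (h : pt S i = pt S j) : i = j := by
  have := hinj (show lineOf m T S ⟨i, by omega⟩ = lineOf m T S ⟨j, by omega⟩ from h)
  simpa using this

/-- `hid ≤ T`. -/
theorem hid_le (m T : ℕ) : hid m T ≤ T := min_le_left _ _
/-- `hid ≤ 2^(m-4)`. -/
theorem hid_le_pow (m T : ℕ) : hid m T ≤ 2 ^ (m - 4) := min_le_right _ _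

/-- `pre + hid = T`. -/
theorem pre_add_hid (m T : ℕ) : pre m T + hid m T = T := Nat.sub_add_cancel (hid_le m T)
/-- `pre ≤ T`. -/
theorem pre_le (m T : ℕ) : pre m T ≤ T := Nat.sub_le _ _

/-- `1 ≤ hid` as soon as `1 ≤ T`. -/
theorem one_le_hid {m T : ℕ} (hT : 1 ≤ T) : 1 ≤ hid m T := le_min hT Nat.one_le_two_pow

/-- A cut position `pre ≤ k` leaves at most `hid` steps to the sink: `T - k ≤ hid`. -/
theorem sub_le_hid_of_pre_le {m T k : ℕ} (hk : pre m T ≤ k) : T - k ≤ hid m T := by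
  have := pre_add_hid m T
  omega

/-- The pinned prefix: `x_i = i` for `i ≤ pre`. -/
theorem val_pt_of_le_pre {S : Equiv.Perm (Fin (2 ^ m))} (hS : InFamily m T S) :
    ∀ i : ℕ, i ≤ pre m T → (pt S i).val = i := by
  intro i
  induction i with
  | zero => intro _; simp [pt_zero, src]
  | succ i ih =>
    intro hi
    have h := ih (Nat.le_of_succ_le hi)
    have hlt : (pt S i).val < pre m T := by rw [h]; exact hi
    rw [pt_succ, hS.1 _ hlt, h]

/-- The surgery `S * swap(a, v)` sends the cut point `a` to `S v`. -/
theorem surgery_apply_cut (S : Equiv.Perm (Fin (2 ^ m))) (a v : Fin (2 ^ m)) :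
    (S * Equiv.swap a v) a = S v := by
  simp [Equiv.Perm.mul_apply, Equiv.swap_apply_left]

/-- The surgery `S * swap(a, v)` sends `v` to `S a`. -/
theorem surgery_apply_v (S : Equiv.Perm (Fin (2 ^ m))) (a v : Fin (2 ^ m)) :
    (S * Equiv.swap a v) v = S a := by
  simp [Equiv.Perm.mul_apply, Equiv.swap_apply_right]

/-- … and agrees with `S` on every other row. -/
theorem surgery_apply_of_ne (S : Equiv.Perm (Fin (2 ^ m))) {a v x : Fin (2 ^ m)} (ha : x ≠ a)
    (hv : x ≠ v) : (S * Equiv.swap a v) x = S x := by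
  simp [Equiv.Perm.mul_apply, Equiv.swap_apply_of_ne_of_ne ha hv]

/-- Conversely, a row where `S * swap(a, v)` and `S` differ is `a` or `v`. -/
theorem eq_or_eq_of_surgery_apply_ne (S : Equiv.Perm (Fin (2 ^ m))) {a v x : Fin (2 ^ m)}
    (h : (S * Equiv.swap a v) x ≠ S x) : x = a ∨ x = v := by
  by_contra hx
  push Not at hx
  exact h (surgery_apply_of_ne S hx.1 hx.2)

/-- The lines of `S` and of a surgery `S * swap(x_k, v)` (`k ≤ T`, `v` off the line) agree up to
position `k`. -/
theorem pt_surgery_of_le {S : Equiv.Perm (Fin (2 ^ m))} (hinj : Function.Injective (lineOf m T S))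
    {k : ℕ} (hk : k ≤ T) {v : Fin (2 ^ m)} (hv : ∀ i : ℕ, i ≤ T → v ≠ pt S i) :
    ∀ i : ℕ, i ≤ k → pt (S * Equiv.swap (pt S k) v) i = pt S i := by
  intro i
  induction i with
  | zero => intro _; rw [pt_zero, pt_zero]
  | succ i ih =>
    intro hi
    have hik : i < k := hi
    rw [pt_succ, pt_succ, ih hik.le]
    apply surgery_apply_of_ne
    · intro h
      have := pt_injOn_of_injective hinj (by omega) hk h
      omega
    · exact (hv i (by omega)).symm

/-! ### Instances of family members -/

/-- A family member's instance has the verifiable line `x_i = S^i(0)`. -/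
theorem isSvlLine_permInstance {S : Equiv.Perm (Fin (2 ^ m))} (hS : InFamily m T S) :
    IsSvlLine (permInstance m T S) (lineOf m T S) := by
  rw [permInstance, isSvlLine_iff]
  refine ⟨hS.2.1, ?_, fun i => ?_, fun x i => ?_⟩
  · simp [lineOf, pt_zero, src]
  · rw [svlSucc_svlInput]
    simp only [lineOf, Fin.val_castSucc, Fin.val_succ, pt_succ]
  · rw [svlVerify_svlInput]

/-- Hence it lies in the promise set. -/
theorem permInstance_mem {S : Equiv.Perm (Fin (2 ^ m))} (hS : InFamily m T S) :
    permInstance m T S ∈ svlPromise m T :=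
  ⟨lineOf m T S, isSvlLine_permInstance hS⟩

/-- Family instances are promise instances (`∀`-form of `permInstance_mem`; the registered
sub-goal this definitions file discharges). -/
theorem permInstance_mem_svlPromise : ∀ (m T : ℕ) (S : Equiv.Perm (Fin (2 ^ m))),
    InFamily m T S → permInstance m T S ∈ svlPromise m T := fun _ _ _ h => permInstance_mem h

/-- And its SVL bit is the parity of `x_T`. -/
theorem svlSinkBit_permInstance {S : Equiv.Perm (Fin (2 ^ m))} (hS : InFamily m T S) :
    svlSinkBit m T (permInstance m T S) = sinkOdd m T S :=
  (isSvlLine_permInstance hS).svlSinkBit_eq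

/-- Reading the S-table of a permutation instance. -/
@[simp] theorem svlSucc_permInstance (S : Equiv.Perm (Fin (2 ^ m))) (x : Fin (2 ^ m)) :
    svlSucc (permInstance m T S) x = S x :=
  svlSucc_svlInput _ _ _

/-- Reading a bit of the S-table of a permutation instance. -/
@[simp] theorem svlSuccBit_permInstance (S : Equiv.Perm (Fin (2 ^ m))) (x : Fin (2 ^ m))
    (j : Fin m) : svlSuccBit (permInstance m T S) x j = (S x).val.testBit j.val :=
  svlSuccBit_svlInput _ _ _ _

/-- Reading the V-table of a permutation instance. -/
@[simp] theorem svlVerify_permInstance (S : Equiv.Perm (Fin (2 ^ m))) (x : Fin (2 ^ m))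
    (i : Fin (T + 1)) : svlVerify (permInstance m T S) x i = decide (x = lineOf m T S i) :=
  svlVerify_svlInput _ _ _ _

/-- The instance determines the permutation (its S-table IS the permutation). -/
theorem permInstance_injective : Function.Injective (permInstance m T) := by
  intro S₁ S₂ h
  ext x
  have h' := congrArg (fun t => svlSucc t x) h
  simp only [svlSucc_permInstance] at h'
  rw [h']

/-- Unpacking membership in `famX`. -/
theorem mem_famX {t : SVLInput m T} :
    t ∈ famX m T ↔ ∃ S : Equiv.Perm (Fin (2 ^ m)),
      (InFamily m T S ∧ sinkOdd m T S = false) ∧ permInstance m T S = t := by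
  unfold famX
  simp only [Finset.mem_image, Finset.mem_filter, Finset.mem_univ, true_and]

/-- Unpacking membership in `famY`. -/
theorem mem_famY {t : SVLInput m T} :
    t ∈ famY m T ↔ ∃ S : Equiv.Perm (Fin (2 ^ m)),
      (InFamily m T S ∧ sinkOdd m T S = true) ∧ permInstance m T S = t := by
  unfold famY
  simp only [Finset.mem_image, Finset.mem_filter, Finset.mem_univ, true_and]

/-- Unpacking membership in `rel`. -/
theorem mem_rel {p : SVLInput m T × SVLInput m T} :
    p ∈ rel m T ↔ ∃ S S' : Equiv.Perm (Fin (2 ^ m)), IsSurgery m T S S' ∧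
      sinkOdd m T S = false ∧ sinkOdd m T S' = true ∧
        p = (permInstance m T S, permInstance m T S') := by
  unfold rel
  simp only [Finset.mem_image, Finset.mem_filter, Finset.mem_univ, true_and, Prod.exists]
  exact ⟨fun ⟨S, S', ⟨h1, h2, h3⟩, h4⟩ => ⟨S, S', h1, h2, h3, h4.symm⟩,
    fun ⟨S, S', h1, h2, h3, h4⟩ => ⟨S, S', ⟨h1, h2, h3⟩, h4.symm⟩⟩

/-- Membership in `rel` for a pair of permutation instances. -/
theorem mk_mem_rel_iff {S S' : Equiv.Perm (Fin (2 ^ m))} :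
    (permInstance m T S, permInstance m T S') ∈ rel m T ↔
      IsSurgery m T S S' ∧ sinkOdd m T S = false ∧ sinkOdd m T S' = true := by
  rw [mem_rel]
  constructor
  · rintro ⟨S₁, S₁', h1, h2, h3, h4⟩
    obtain ⟨e1, e2⟩ := Prod.mk.inj h4
    cases permInstance_injective e1
    cases permInstance_injective e2
    exact ⟨h1, h2, h3⟩
  · rintro ⟨h1, h2, h3⟩
    exact ⟨S, S', h1, h2, h3, rfl⟩

/-- **Well-formedness.** Every pair of `rel` joins an `X`-instance to a `Y`-instance, both in
the promise set, with sink bits `false` / `true`. -/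
theorem rel_wellFormed (m T : ℕ) : ∀ p ∈ rel m T,
    p.1 ∈ famX m T ∧ p.2 ∈ famY m T ∧ p.1 ∈ svlPromise m T ∧ p.2 ∈ svlPromise m T ∧
      svlSinkBit m T p.1 = false ∧ svlSinkBit m T p.2 = true := by
  intro p hp
  obtain ⟨S, S', hSS', h0, h1, rfl⟩ := mem_rel.1 hp
  have hS : InFamily m T S := hSS'.1
  have hS' : InFamily m T S' := hSS'.2.1
  refine ⟨?_, ?_, permInstance_mem hS, permInstance_mem hS', ?_, ?_⟩
  · exact mem_famX.2 ⟨S, ⟨hS, h0⟩, rfl⟩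
  · exact mem_famY.2 ⟨S', ⟨hS', h1⟩, rfl⟩
  · show svlSinkBit m T (permInstance m T S) = false
    rw [svlSinkBit_permInstance hS, h0]
  · show svlSinkBit m T (permInstance m T S') = true
    rw [svlSinkBit_permInstance hS', h1]

end Family

/-- `L* = max (N², 4 · hid² · N)`, `N = 2^m`: the per-pair per-bit product bound of the line. -/
def Lstar (m T : ℕ) : ℝ := max ((2 : ℝ) ^ m * 2 ^ m) (4 * (hid m T : ℝ) ^ 2 * 2 ^ m)

/-- `d* = hid · N / 8`: the min-degree bound of the line. -/
def dstar (m T : ℕ) : ℝ := (hid m T : ℝ) * 2 ^ m / 8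

/-! ## §3 Counting vocabulary for the degree bound -/

section Counting

variable {m T : ℕ}

/-- `v` is off the `S`-orbit of the source (on another cycle of `S`). -/
def OffCycle (S : Equiv.Perm (Fin (2 ^ m))) (v : Fin (2 ^ m)) : Prop := ∀ j : ℕ, pt S j ≠ v

/-- The length of the `S`-orbit of the source (its minimal period). -/
def srcPeriod (S : Equiv.Perm (Fin (2 ^ m))) : ℕ := Function.minimalPeriod S (src m)

/-- Every point of a permutation of a finite type is periodic. -/
theorem mem_periodicPts (S : Equiv.Perm (Fin (2 ^ m))) (x : Fin (2 ^ m)) :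
    x ∈ Function.periodicPts S := by
  rw [(Function.injective_iff_periodicPts_eq_univ (f := (S : Fin (2 ^ m) → Fin (2 ^ m)))).1
    S.injective]
  trivial

/-- The source period is positive. -/
theorem srcPeriod_pos (S : Equiv.Perm (Fin (2 ^ m))) : 0 < srcPeriod S :=
  Function.minimalPeriod_pos_of_mem_periodicPts (mem_periodicPts S _)

/-- `pt` as an iterate. -/
theorem pt_eq_iterate (S : Equiv.Perm (Fin (2 ^ m))) (i : ℕ) : pt S i = (S : _ → _)^[i] (src m) := by
  rw [pt, Equiv.Perm.iterate_eq_pow]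

/-- The orbit of the source closes up after `srcPeriod S` steps. -/
theorem pt_srcPeriod (S : Equiv.Perm (Fin (2 ^ m))) : pt S (srcPeriod S) = src m := by
  rw [pt_eq_iterate]
  exact Function.iterate_minimalPeriod

/-- The orbit of the source is periodic with period `srcPeriod S`. -/
theorem pt_add_srcPeriod (S : Equiv.Perm (Fin (2 ^ m))) (i : ℕ) :
    pt S (i + srcPeriod S) = pt S i := by
  rw [add_comm, pt_add, pt_srcPeriod, ← pt]

/-- The orbit reduces modulo the period. -/
theorem pt_mod_srcPeriod (S : Equiv.Perm (Fin (2 ^ m))) (i : ℕ) :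
    pt S (i % srcPeriod S) = pt S i := by
  rw [pt_eq_iterate, pt_eq_iterate]
  exact Function.iterate_mod_minimalPeriod_eq

/-- Below the period the orbit points are pairwise distinct. -/
theorem pt_injOn_lt_srcPeriod (S : Equiv.Perm (Fin (2 ^ m))) {i j : ℕ} (hi : i < srcPeriod S)
    (hj : j < srcPeriod S) (h : pt S i = pt S j) : i = j := by
  rw [pt_eq_iterate, pt_eq_iterate] at h
  exact Function.iterate_injOn_Iio_minimalPeriod hi hj h

/-- A point of the orbit of the source is `pt S i` for some `i < srcPeriod S`. -/
theorem exists_lt_srcPeriod_of_not_offCycle {S : Equiv.Perm (Fin (2 ^ m))} {v : Fin (2 ^ m)}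
    (h : ¬ OffCycle S v) : ∃ i : ℕ, i < srcPeriod S ∧ pt S i = v := by
  unfold OffCycle at h
  push Not at h
  obtain ⟨j, hj⟩ := h
  exact ⟨j % srcPeriod S, Nat.mod_lt _ (srcPeriod_pos S), by rw [pt_mod_srcPeriod, hj]⟩

/-- A simple line `x_0, …, x_T` forces the source period to exceed `T`. -/
theorem lt_srcPeriod_of_injective {S : Equiv.Perm (Fin (2 ^ m))}
    (hinj : Function.Injective (lineOf m T S)) : T < srcPeriod S := by
  by_contra h
  push Not at h
  have h0 := pt_injOn_of_injective hinj h (Nat.zero_le T) (by rw [pt_srcPeriod, pt_zero])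
  exact (srcPeriod_pos S).ne' h0

open scoped Classical in
/-- Merge vertices at cut `k` with new-sink parity `b`: names `v` off the source cycle whose
image `S^(T-k) v` (the sink of `S * swap(x_k, v)`) has parity `b`. -/
def mergeGood (m T : ℕ) (S : Equiv.Perm (Fin (2 ^ m))) (k : ℕ) (b : Bool) : Finset (Fin (2 ^ m)) :=
  Finset.univ.filter fun v => OffCycle S v ∧ decide (((S ^ (T - k)) v).val % 2 = 1) = b

/-- Far-split positions at cut `k` with new-sink parity `b`: indices `q` on the source cycle with
`k + hid < q` (the excised cycle `x_{k+1} … x_q` is longer than `hid`) and `q + (T - k) < srcPeriod`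
(the sink `x_{q+T-k}` of `S * swap(x_k, x_q)` is reached before the cycle closes), of parity `b`. -/
def splitGood (m T : ℕ) (S : Equiv.Perm (Fin (2 ^ m))) (k : ℕ) (b : Bool) : Finset ℕ :=
  (Finset.range (srcPeriod S)).filter fun q =>
    k + hid m T < q ∧ q + (T - k) < srcPeriod S ∧ decide ((pt S (q + (T - k))).val % 2 = 1) = b

/-- Unpacking membership in `mergeGood`. -/
theorem mem_mergeGood {S : Equiv.Perm (Fin (2 ^ m))} {k : ℕ} {b : Bool} {v : Fin (2 ^ m)} :
    v ∈ mergeGood m T S k b ↔ OffCycle S v ∧ decide (((S ^ (T - k)) v).val % 2 = 1) = b := by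
  classical
  unfold mergeGood
  simp only [Finset.mem_filter, Finset.mem_univ, true_and]

/-- Unpacking membership in `splitGood`. -/
theorem mem_splitGood {S : Equiv.Perm (Fin (2 ^ m))} {k : ℕ} {b : Bool} {q : ℕ} :
    q ∈ splitGood m T S k b ↔ k + hid m T < q ∧ q + (T - k) < srcPeriod S ∧
      decide ((pt S (q + (T - k))).val % 2 = 1) = b := by
  unfold splitGood
  simp only [Finset.mem_filter, Finset.mem_range]
  constructor
  · rintro ⟨-, h⟩; exact h
  · rintro h; exact ⟨by omega, h⟩

end Counting



section Adversary

variable {n : ℕ}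

/-- `l_{x,i}`: the number of pairs `(x, y') ∈ R` (partners of `x` on the left) with `x_i ≠ y'_i`. -/
def leftCount (R : Finset ((Fin n → Bool) × (Fin n → Bool))) (x : Fin n → Bool) (i : Fin n) : ℕ :=
  (R.filter fun q => q.1 = x ∧ q.1 i ≠ q.2 i).card

/-- `l_{y,i}`: the number of pairs `(x', y) ∈ R` (partners of `y` on the right) with `x'_i ≠ y_i`. -/
def rightCount (R : Finset ((Fin n → Bool) × (Fin n → Bool))) (y : Fin n → Bool) (i : Fin n) : ℕ :=
  (R.filter fun q => q.2 = y ∧ q.1 i ≠ q.2 i).card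

/-- Left degree of `x` in `R`. -/
def leftDeg (R : Finset ((Fin n → Bool) × (Fin n → Bool))) (x : Fin n → Bool) : ℕ :=
  (R.filter fun q => q.1 = x).card

/-- Right degree of `y` in `R`. -/
def rightDeg (R : Finset ((Fin n → Bool) × (Fin n → Bool))) (y : Fin n → Bool) : ℕ :=
  (R.filter fun q => q.2 = y).card

/-- Ambainis's product hypothesis: for every related pair and every bit where the pair differs,
`l_{x,i} · l_{y,i} ≤ L`. -/
def ProductBound (R : Finset ((Fin n → Bool) × (Fin n → Bool))) (L : ℝ) : Prop :=
  ∀ p ∈ R, ∀ i : Fin n, p.1 i ≠ p.2 i → (leftCount R p.1 i : ℝ) * rightCount R p.2 i ≤ L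

/-- The relation lives on `X × Y`, inside the promise, and separates `f`-values. -/
def RelWellFormed (D : Set (Fin n → Bool)) (f : (Fin n → Bool) → Bool) (X Y : Finset (Fin n → Bool))
    (R : Finset ((Fin n → Bool) × (Fin n → Bool))) : Prop :=
  ∀ p ∈ R, p.1 ∈ X ∧ p.2 ∈ Y ∧ p.1 ∈ D ∧ p.2 ∈ D ∧ f p.1 ≠ f p.2

/-- A degree is at most the size of the relation (the registered sub-goal this definitions file
discharges). -/
theorem leftDeg_le_card : ∀ {n : ℕ} (R : Finset ((Fin n → Bool) × (Fin n → Bool))) (x : Fin n → Bool),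
    leftDeg R x ≤ R.card := fun R _ => Finset.card_filter_le R _

end Adversary



/-! ## §4 Anatomy and symmetry of the surgery (lead prover) -/

section Anatomy

variable {m T : ℕ}

/-- **Tail of a surgery.** Let `S' = S * swap(x_k, v)` with `k ≤ T`, `v` off the line of `S`,
`v` of `S`-period `> T - k`, and suppose the lines of `S` and `S'` are both simple. Then for
`k + 1 + j ≤ T` the `(k+1+j)`-th point of the line of `S'` is `S^(j+1) v`, and this point is off
the line of `S` (uniformly in the merge case — `v` on another cycle — and the far-split case). -/
theorem surgery_tail {S : Equiv.Perm (Fin (2 ^ m))} (hinj : Function.Injective (lineOf m T S))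
    {k : ℕ} (hk : k ≤ T) {v : Fin (2 ^ m)} (hv : ∀ i : ℕ, i ≤ T → v ≠ pt S i)
    (hcyc : ∀ j : ℕ, 0 < j → j ≤ T - k → (S ^ j) v ≠ v)
    (hinj' : Function.Injective (lineOf m T (S * Equiv.swap (pt S k) v))) :
    ∀ j : ℕ, k + 1 + j ≤ T →
      pt (S * Equiv.swap (pt S k) v) (k + 1 + j) = (S ^ (j + 1)) v ∧
        ∀ i : ℕ, i ≤ T → (S ^ (j + 1)) v ≠ pt S i := by
  set S' := S * Equiv.swap (pt S k) v with hS'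
  -- an orbit point of `v` under `S` that lands on the line of `S` lands on the source,
  -- and then the line of `S'` is not simple
  have offline : ∀ j : ℕ, k + 1 + j ≤ T → pt S' (k + 1 + j) = (S ^ (j + 1)) v →
      (∀ i : ℕ, i ≤ T → (S ^ j) v ≠ pt S i) → ∀ i : ℕ, i ≤ T → (S ^ (j + 1)) v ≠ pt S i := by
    intro j hj hpt hprev i hi h
    rcases Nat.eq_zero_or_pos i with rfl | hipos
    · -- lands on the source: contradicts simplicity of the line of `S'`
      rw [pt_zero] at h
      have h0 : pt S' (k + 1 + j) = pt S' 0 := by rw [hpt, h, pt_zero]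
      have := pt_injOn_of_injective hinj' hj (Nat.zero_le _) h0
      omega
    · -- lands on `x_i`, `i ≥ 1`: then `S^j v = x_{i-1}`
      obtain ⟨i', rfl⟩ : ∃ i', i = i' + 1 := ⟨i - 1, by omega⟩
      rw [pt_succ, pow_succ', Equiv.Perm.mul_apply] at h
      exact hprev i' (by omega) (S.injective h)
  intro j
  induction j with
  | zero =>
    intro hj
    have hpt : pt S' (k + 1 + 0) = (S ^ (0 + 1)) v := by
      rw [add_zero, zero_add, pow_one, pt_succ, pt_surgery_of_le hinj hk hv k le_rfl, hS',
        surgery_apply_cut]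
    refine ⟨hpt, offline 0 hj hpt ?_⟩
    intro i hi
    rw [pow_zero, Equiv.Perm.one_apply]
    exact hv i hi
  | succ j ih =>
    intro hj
    obtain ⟨hpt, hoff⟩ := ih (by omega)
    have hne_cut : (S ^ (j + 1)) v ≠ pt S k := hoff k hk
    have hne_v : (S ^ (j + 1)) v ≠ v := hcyc (j + 1) (Nat.succ_pos j) (by omega)
    have hpt' : pt S' (k + 1 + (j + 1)) = (S ^ (j + 1 + 1)) v := by
      rw [show k + 1 + (j + 1) = (k + 1 + j) + 1 by omega, pt_succ, hpt, hS',
        surgery_apply_of_ne S hne_cut hne_v, pow_succ' S (j + 1), Equiv.Perm.mul_apply]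
    exact ⟨hpt', offline (j + 1) hj hpt' hoff⟩

/-- **Anatomy of a surgery pair.** If `IsSurgery m T S S'` then, for the cut `k` and the vertex
`v` of the definition: the lines agree up to position `k`, and for `k < i ≤ T` the `i`-th point
of the line of `S'` is `S^(i-k) v`, which is off the line of `S` (in particular differs from
`x_i`) and differs from `v`. -/
theorem IsSurgery.anatomy {S S' : Equiv.Perm (Fin (2 ^ m))} (h : IsSurgery m T S S') :
    ∃ k : ℕ, pre m T ≤ k ∧ k < T ∧ ∃ v : Fin (2 ^ m),
      (∀ i : ℕ, i ≤ T → v ≠ pt S i) ∧ S' = S * Equiv.swap (pt S k) v ∧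
      (∀ i : ℕ, i ≤ k → pt S' i = pt S i) ∧
      ∀ i : ℕ, k < i → i ≤ T →
        pt S' i = (S ^ (i - k)) v ∧ (∀ i' : ℕ, i' ≤ T → pt S' i ≠ pt S i') ∧ pt S' i ≠ v := by
  obtain ⟨hS, hS', k, hk, hkT, v, hv, rfl⟩ := h
  refine ⟨k, hk, hkT, v, hv, rfl, pt_surgery_of_le hS.2.1 hkT.le hv, ?_⟩
  have hcyc : ∀ j : ℕ, 0 < j → j ≤ T - k → (S ^ j) v ≠ v :=
    fun j hj hjk => hS.2.2 v j hj (hjk.trans (sub_le_hid_of_pre_le hk))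
  intro i hki hiT
  obtain ⟨j, rfl⟩ : ∃ j, i = k + 1 + j := ⟨i - (k + 1), by omega⟩
  obtain ⟨hpt, hoff⟩ := surgery_tail hS.2.1 hkT.le hv hcyc hS'.2.1 j hiT
  have hsub : k + 1 + j - k = j + 1 := by omega
  refine ⟨by rw [hpt, hsub], fun i' hi' => by rw [hpt]; exact hoff i' hi', ?_⟩
  rw [hpt]
  exact hcyc (j + 1) (Nat.succ_pos j) (by omega)

/-- **Symmetry of the surgery relation** (the former `stub_surgerySymm`): if `S' = S * swap(x_k, v)`
is a surgery of `S` then `S = S' * swap(x'_k, v)` is a surgery of `S'` with the same cut (the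
lines agree up to `k`, so `x'_k = x_k`) and the same vertex `v`, which is off the line of `S'`
(its points beyond the cut are `S^j v ≠ v`, `1 ≤ j ≤ T - k ≤ hid <` period of `v`). -/
theorem IsSurgery.symm {S S' : Equiv.Perm (Fin (2 ^ m))} (h : IsSurgery m T S S') :
    IsSurgery m T S' S := by
  have hS : InFamily m T S := h.1
  have hS' : InFamily m T S' := h.2.1
  obtain ⟨k, hk, hkT, v, hv, hSS', hagree, htail⟩ := h.anatomy
  refine ⟨hS', hS, k, hk, hkT, v, fun i hi => ?_, ?_⟩
  · rcases Nat.lt_or_ge k i with hki | hik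
    · exact fun h => (htail i hki hi).2.2 h.symm
    · rw [hagree i hik]
      exact hv i hi
  · rw [hagree k le_rfl, hSS', mul_assoc, Equiv.swap_mul_self, mul_one]

/-- Beyond the cut the two lines of a surgery pair are disjoint from each other pointwise:
`x'_i ≠ x_i` for `k < i ≤ T`; below it they agree. Packaged for the counting stubs. -/
theorem IsSurgery.pt_ne_iff {S S' : Equiv.Perm (Fin (2 ^ m))} (h : IsSurgery m T S S') :
    ∃ k : ℕ, pre m T ≤ k ∧ k < T ∧ ∀ i : ℕ, i ≤ T → (pt S' i ≠ pt S i ↔ k < i) := by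
  obtain ⟨k, hk, hkT, v, -, -, hagree, htail⟩ := h.anatomy
  refine ⟨k, hk, hkT, fun i hi => ⟨fun hne => ?_, fun hki => (htail i hki hi).2.1 i hi⟩⟩
  by_contra hki
  exact hne (hagree i (Nat.le_of_not_lt hki))

/-- `∀`-form of `IsSurgery.symm` (the registered sub-goal this file discharges; the planner's
former `stub_surgerySymm`). -/
theorem isSurgery_symm : ∀ (m T : ℕ) (S S' : Equiv.Perm (Fin (2 ^ m))),
    IsSurgery m T S S' → IsSurgery m T S' S := fun _ _ _ _ h => h.symm

end Anatomy

/-! ## Registered stubs -/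

/-- **stub_relationalAdversary** (size L) — Ambainis's relational adversary bound in AVERAGE-degree form
[Ambainis, *Quantum lower bounds by quantum arguments*, JCSS 64 (2002), Thm 6; Høyer–Špalek 2005 Thm 2
with the uniform unit vector on `X ⊔ Y`], for the tree's model `QQueryAlg` and PROMISE problems: if `A`
computes `f` with error `1/3` on `D` and `R ⊆ X × Y` is well formed with product bound `L`, then
`|R| ≤ 144 · A.queries · √L · √(|X| · |Y|)`. Proof route: progress `W^t = ∑_{(x,y)∈R} Re⟨ψ_x^t|ψ_y^t⟩`,
`W⁰ = |R|`, `W^T ≤ (1 - 1/72)|R|` (`SpectralAdversary.rinner_le_of_gap`), and per query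
`|W^t - W^{t+1}| ≤ ∑_R ∑_{i : x_i ≠ y_i} 2 β_{x,i} β_{y,i} ≤ 2 √L √(|X||Y|)` by `2ab ≤ w a² + b²/w` with
`w = √(l_{y,i}/l_{x,i}) · √(|Y|/|X|)` and `∑_i β_{x,i}² = 1` (`fiberWeight`, `sum_fiberWeight`); the
multi-position oracle step generalises `rinner_sub_rinner_oracle` / `weighted_abs_sub_le`. -/
theorem stub_relationalAdversary :
    ∀ (n : ℕ) (A : QQueryAlg n) (D : Set (Fin n → Bool)) (f : (Fin n → Bool) → Bool),
      A.ComputesWithError (1 / 3) D f →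
      ∀ (X Y : Finset (Fin n → Bool)) (R : Finset ((Fin n → Bool) × (Fin n → Bool))) (L : ℝ),
        RelWellFormed D f X Y R → ProductBound R L →
          (R.card : ℝ) ≤ 144 * A.queries * Real.sqrt L * Real.sqrt ((X.card : ℝ) * Y.card) := by
  sorry

/-- **stub_pairProducts** (size M–L) — for every pair of `rel m T` and every input bit where the two
instances differ, the Ambainis product is `≤ Lstar m T = max (N², 4 hid² N)`: a surgery pair
`S' = S * swap(x_k, v)` differs exactly at the S-rows `x_k`, `v` and the V-cells `(x_i, i)`, `(x'_i, i)`,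
`k < i ≤ T` (`IsSurgery.anatomy`); row `x_k`: `≤ N` partners on either side (cut `= k`), row `v`: `≤ hid`
(one per cut), a marked V-cell is lost under `≤ hid · N` surgeries and ACQUIRED by `≤ hid` (one vertex
`v'' = S^{-(i-k'')} x` per cut `k'' < i`, by the anatomy); right-hand counts via `IsSurgery.symm`. -/
theorem stub_pairProducts :
    ∀ m T : ℕ, 4 ≤ m → 1 ≤ T → T + 1 ≤ 2 ^ (m - 1) → ProductBound (rel m T) (Lstar m T) := by
  sorry

/-- **stub_partnerFamily** (size M–L, lead) — the partners used by the degree bound stay in the family: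
for `S` in the family and a cut `pre ≤ k < T`, (merge) for every `v` off the source cycle,
`S * swap(x_k, v)` is in the family and its sink is `S^(T-k) v`; (far split) for every position `q` of
the source cycle with `k + hid < q` and `q + (T - k) < srcPeriod S`, `S * swap(x_k, x_q)` is in the
family and its sink is `x_{q + T - k}`. -/
theorem stub_partnerFamily :
    ∀ (m T : ℕ) (S : Equiv.Perm (Fin (2 ^ m))) (k : ℕ), InFamily m T S → pre m T ≤ k → k < T →
      (∀ v : Fin (2 ^ m), OffCycle S v →
          InFamily m T (S * Equiv.swap (pt S k) v) ∧
            pt (S * Equiv.swap (pt S k) v) T = (S ^ (T - k)) v) ∧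
      ∀ q : ℕ, k + hid m T < q → q + (T - k) < srcPeriod S →
          InFamily m T (S * Equiv.swap (pt S k) (pt S q)) ∧
            pt (S * Equiv.swap (pt S k) (pt S q)) T = pt S (q + (T - k)) := by
  sorry

/-- **stub_goodSetCard** (size M) — the parity count behind the min degree: for `S` in the family
(`4 ≤ m`, `1 ≤ T`, `T + 1 ≤ 2^(m-1)`), a cut `pre ≤ k < T` and a target parity `b`, at least `2^(m-3)`
partners at cut `k` have a sink of parity `b`: `v ↦ S^(T-k) v` permutes the off-cycle names, the far
splits contribute the cycle positions `T + hid < p < srcPeriod`, so the good set is all names of parity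
`b` except at most those among `x_0, …, x_{T+hid}`, i.e. at most `⌊pre/2⌋ + 1 ≤ 2^(m-2)` prefix names
(`x_i = i`, `i ≤ pre`) plus `2 · hid ≤ 2^(m-3)` hidden ones, out of `2^(m-1)`. -/
theorem stub_goodSetCard :
    ∀ (m T : ℕ) (S : Equiv.Perm (Fin (2 ^ m))) (k : ℕ) (b : Bool), 4 ≤ m → 1 ≤ T →
      T + 1 ≤ 2 ^ (m - 1) → InFamily m T S → pre m T ≤ k → k < T →
        2 ^ (m - 3) ≤ (mergeGood m T S k b).card + (splitGood m T S k b).card := by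
  sorry

/-- **stub_familyNonempty** (size M) — both sink parities occur in the family (`4 ≤ m`, `1 ≤ T`,
`T + 1 ≤ 2^(m-1)`): the `2^m`-cycle `x ↦ x + 1` (`finRotate`; sink `T`) and its conjugate by
`swap(T, T+1)` (sink `T + 1`) are family members (prefix rows `i ↦ i+1` for `i < pre ≤ T - 1`, a single
cycle of length `2^m > hid`). -/
theorem stub_familyNonempty :
    ∀ m T : ℕ, 4 ≤ m → 1 ≤ T → T + 1 ≤ 2 ^ (m - 1) →
      (∃ S : Equiv.Perm (Fin (2 ^ m)), InFamily m T S ∧ sinkOdd m T S = false) ∧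
        ∃ S : Equiv.Perm (Fin (2 ^ m)), InFamily m T S ∧ sinkOdd m T S = true := by
  sorry

/-- **stub_degrees** (size M, lead) — the min-degree bound on both sides from the three counting stubs:
the map `(k, v) ↦ (S, S * swap(x_k, v))` injects the good partners of the `hid` cuts into the `rel`-fibre
of `permInstance S` (distinct `(k, v)` give distinct swaps since `x_k` is on the line and `v` off it), so
`leftDeg ≥ hid · 2^(m-3) = dstar`; on the odd side the same count with target parity `false`, transported
by `IsSurgery.symm`; nonemptiness from `stub_familyNonempty`. -/
theorem stub_degrees :
    (∀ (m T : ℕ) (S : Equiv.Perm (Fin (2 ^ m))) (k : ℕ), InFamily m T S → pre m T ≤ k → k < T →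
      (∀ v : Fin (2 ^ m), OffCycle S v →
          InFamily m T (S * Equiv.swap (pt S k) v) ∧
            pt (S * Equiv.swap (pt S k) v) T = (S ^ (T - k)) v) ∧
      ∀ q : ℕ, k + hid m T < q → q + (T - k) < srcPeriod S →
          InFamily m T (S * Equiv.swap (pt S k) (pt S q)) ∧
            pt (S * Equiv.swap (pt S k) (pt S q)) T = pt S (q + (T - k))) →
    (∀ (m T : ℕ) (S : Equiv.Perm (Fin (2 ^ m))) (k : ℕ) (b : Bool), 4 ≤ m → 1 ≤ T →
      T + 1 ≤ 2 ^ (m - 1) → InFamily m T S → pre m T ≤ k → k < T →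
        2 ^ (m - 3) ≤ (mergeGood m T S k b).card + (splitGood m T S k b).card) →
    (∀ m T : ℕ, 4 ≤ m → 1 ≤ T → T + 1 ≤ 2 ^ (m - 1) →
      (∃ S : Equiv.Perm (Fin (2 ^ m)), InFamily m T S ∧ sinkOdd m T S = false) ∧
        ∃ S : Equiv.Perm (Fin (2 ^ m)), InFamily m T S ∧ sinkOdd m T S = true) →
    ∀ m T : ℕ, 4 ≤ m → 1 ≤ T → T + 1 ≤ 2 ^ (m - 1) →
      (famX m T).Nonempty ∧ (famY m T).Nonempty ∧
        (∀ t ∈ famX m T, dstar m T ≤ (leftDeg (rel m T) t : ℝ)) ∧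
          ∀ t ∈ famY m T, dstar m T ≤ (rightDeg (rel m T) t : ℝ) := by
  sorry

/-! ## Composition (sorry-free modulo the stubs) -/

section Composition

/-- `|R| ≥ d · |X|` from a left min-degree bound (fibrewise counting). -/
theorem card_mul_le_of_leftDeg {n : ℕ} {X : Finset (Fin n → Bool)}
    {R : Finset ((Fin n → Bool) × (Fin n → Bool))} {d : ℝ}
    (hmaps : ∀ p ∈ R, p.1 ∈ X) (hdeg : ∀ t ∈ X, d ≤ (leftDeg R t : ℝ)) :
    d * X.card ≤ (R.card : ℝ) := by
  have hfib : R.card = ∑ t ∈ X, leftDeg R t :=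
    Finset.card_eq_sum_card_fiberwise (f := Prod.fst) (s := R) (t := X) fun p hp => hmaps p hp
  rw [hfib, Nat.cast_sum]
  calc d * X.card = ∑ t ∈ X, d := by rw [Finset.sum_const, nsmul_eq_mul, mul_comm]
    _ ≤ ∑ t ∈ X, (leftDeg R t : ℝ) := Finset.sum_le_sum fun t ht => hdeg t ht

/-- `|R| ≥ d · |Y|` from a right min-degree bound. -/
theorem card_mul_le_of_rightDeg {n : ℕ} {Y : Finset (Fin n → Bool)}
    {R : Finset ((Fin n → Bool) × (Fin n → Bool))} {d : ℝ}
    (hmaps : ∀ p ∈ R, p.2 ∈ Y) (hdeg : ∀ t ∈ Y, d ≤ (rightDeg R t : ℝ)) :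
    d * Y.card ≤ (R.card : ℝ) := by
  have hfib : R.card = ∑ t ∈ Y, rightDeg R t :=
    Finset.card_eq_sum_card_fiberwise (f := Prod.snd) (s := R) (t := Y) fun p hp => hmaps p hp
  rw [hfib, Nat.cast_sum]
  calc d * Y.card = ∑ t ∈ Y, d := by rw [Finset.sum_const, nsmul_eq_mul, mul_comm]
    _ ≤ ∑ t ∈ Y, (rightDeg R t : ℝ) := Finset.sum_le_sum fun t ht => hdeg t ht

/-- The abstract adversary inequality: if `d|X| ≤ |R|`, `d|Y| ≤ |R|`, `|R| ≤ K √(|X||Y|)` with `X, Y`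
nonempty and `d, K ≥ 0`, then `d ≤ K`. -/
theorem le_of_degrees {d K X Y R : ℝ} (hd : 0 ≤ d) (hK : 0 ≤ K) (hX : 0 < X) (hY : 0 < Y)
    (h1 : d * X ≤ R) (h2 : d * Y ≤ R) (h3 : R ≤ K * Real.sqrt (X * Y)) : d ≤ K := by
  have hR : 0 ≤ R := le_trans (by positivity) h1
  have hsq : Real.sqrt (X * Y) ^ 2 = X * Y := Real.sq_sqrt (by positivity)
  have h4 : (d * X) * (d * Y) ≤ R * R := mul_le_mul h1 h2 (by positivity) hR
  have h5 : R ^ 2 ≤ (K * Real.sqrt (X * Y)) ^ 2 := pow_le_pow_left₀ hR h3 2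
  rw [mul_pow, hsq] at h5
  have h6 : d ^ 2 * (X * Y) ≤ K ^ 2 * (X * Y) := by nlinarith
  have h7 : d ^ 2 ≤ K ^ 2 := le_of_mul_le_mul_right h6 (by positivity)
  exact (sq_le_sq₀ hd hK).1 h7

/-- **The combinatorial–analytic core**: the `1/m`-free bound `c · min (T+1) √(2^m) ≤ Q`, `c = 1/4608`,
from the adversary stub, the product stub and the min-degree statement. -/
theorem cruxShape_of_parts (hA : type_of% stub_relationalAdversary) (hB : type_of% stub_pairProducts)
    (hC : ∀ m T : ℕ, 4 ≤ m → 1 ≤ T → T + 1 ≤ 2 ^ (m - 1) →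
      (famX m T).Nonempty ∧ (famY m T).Nonempty ∧
        (∀ t ∈ famX m T, dstar m T ≤ (leftDeg (rel m T) t : ℝ)) ∧
          ∀ t ∈ famY m T, dstar m T ≤ (rightDeg (rel m T) t : ℝ)) :
    ∀ m T : ℕ, 2 ≤ m → 1 ≤ T → T + 1 ≤ 2 ^ (m - 1) →
      (1 / 4608 : ℝ) * min ((T : ℝ) + 1) (Real.sqrt (2 ^ m)) ≤ (svlQ m T : ℝ) := by
  intro m T hm hT hTm
  have hQ1 : (1 : ℝ) ≤ (svlQ m T : ℝ) := by exact_mod_cast one_le_svlQ_of_hyps hT hTm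
  have hNpos : (0 : ℝ) < 2 ^ m := by positivity
  have hsqN : 0 < Real.sqrt (2 ^ m) := Real.sqrt_pos.2 hNpos
  by_cases hm10 : 10 ≤ m
  · -- MAIN CASE `m ≥ 10`: Ambainis on the surgery relation
    have hm4 : 4 ≤ m := le_trans (by norm_num) hm10
    obtain ⟨A, hAq, hAc⟩ := exists_queries_eq_quantumQueryComplexityOn
      (N := 2 ^ m * m + 2 ^ m * (T + 1)) (ε := 1 / 3) (by norm_num) (svlPromise m T) (svlSinkBit m T)
    obtain ⟨hXne, hYne, hdX, hdY⟩ := hC m T hm4 hT hTm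
    have hWF := rel_wellFormed m T
    have hRWF : RelWellFormed (svlPromise m T) (svlSinkBit m T) (famX m T) (famY m T) (rel m T) := by
      intro p hp
      obtain ⟨h1, h2, h3, h4, h5, h6⟩ := hWF p hp
      refine ⟨h1, h2, h3, h4, ?_⟩
      rw [h5, h6]
      decide
    have hmain := hA (2 ^ m * m + 2 ^ m * (T + 1)) A (svlPromise m T) (svlSinkBit m T) hAc
      (famX m T) (famY m T) (rel m T) (Lstar m T) hRWF (hB m T hm4 hT hTm)
    rw [hAq] at hmain
    have hRX : dstar m T * (famX m T).card ≤ ((rel m T).card : ℝ) :=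
      card_mul_le_of_leftDeg (fun p hp => (hWF p hp).1) hdX
    have hRY : dstar m T * (famY m T).card ≤ ((rel m T).card : ℝ) :=
      card_mul_le_of_rightDeg (fun p hp => (hWF p hp).2.1) hdY
    have hXpos : (0 : ℝ) < (famX m T).card := by exact_mod_cast hXne.card_pos
    have hYpos : (0 : ℝ) < (famY m T).card := by exact_mod_cast hYne.card_pos
    have hd0 : 0 ≤ dstar m T := by unfold dstar; positivity
    have hkey : dstar m T ≤ 144 * (svlQ m T : ℝ) * Real.sqrt (Lstar m T) :=
      le_of_degrees hd0 (by positivity) hXpos hYpos hRX hRY hmain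
    set q : ℝ := (svlQ m T : ℝ) with hq
    have hq0 : 0 ≤ q := by positivity
    have hhid1 : 1 ≤ hid m T := le_min hT Nat.one_le_two_pow
    have hhidR : (1 : ℝ) ≤ (hid m T : ℝ) := by exact_mod_cast hhid1
    have hhidpos : (0 : ℝ) < (hid m T : ℝ) := by linarith
    set s : ℝ := Real.sqrt (2 ^ m) with hs
    have hss : s * s = 2 ^ m := Real.mul_self_sqrt hNpos.le
    -- `min (T+1) √N ≤ 4 · hid`
    have hmin4 : min ((T : ℝ) + 1) s ≤ 4 * (hid m T : ℝ) := by
      by_cases hTm4 : T ≤ 2 ^ (m - 4)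
      · have hh : hid m T = T := min_eq_left hTm4
        rw [hh]
        have hT1 : (1 : ℝ) ≤ T := by exact_mod_cast hT
        calc min ((T : ℝ) + 1) s ≤ (T : ℝ) + 1 := min_le_left _ _
          _ ≤ 4 * (T : ℝ) := by linarith
      · have hh : hid m T = 2 ^ (m - 4) := min_eq_right (le_of_lt (Nat.lt_of_not_le hTm4))
        rw [hh]
        push_cast
        have h4 : (4 : ℝ) * 2 ^ (m - 4) = 2 ^ (m - 2) := by
          rw [show (4 : ℝ) = 2 ^ 2 by norm_num, ← pow_add]
          congr 1
          omega
        rw [h4]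
        calc min ((T : ℝ) + 1) s ≤ s := min_le_right _ _
          _ ≤ 2 ^ (m - 2) := by
            rw [hs, Real.sqrt_le_left (by positivity), ← pow_mul]
            exact pow_le_pow_right₀ (by norm_num) (by omega)
    unfold dstar Lstar at hkey
    rcases le_total ((2 : ℝ) ^ m * 2 ^ m) (4 * (hid m T : ℝ) ^ 2 * 2 ^ m) with hle | hle
    · -- Grover branch: `L* = 4 hid² N`, `√L* = 2 · hid · √N`
      rw [max_eq_right hle] at hkey
      have hsqrtL : Real.sqrt (4 * (hid m T : ℝ) ^ 2 * 2 ^ m) = 2 * (hid m T : ℝ) * s := by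
        rw [show (4 : ℝ) * (hid m T : ℝ) ^ 2 * 2 ^ m = (2 * (hid m T : ℝ)) ^ 2 * 2 ^ m by ring,
          Real.sqrt_mul (by positivity), Real.sqrt_sq (by positivity)]
      rw [hsqrtL, ← hss] at hkey
      have h1 : s ≤ 2304 * q := by
        nlinarith [mul_pos hhidpos hsqN, hkey]
      calc (1 / 4608 : ℝ) * min ((T : ℝ) + 1) s ≤ (1 / 4608) * s := by
            gcongr
            exact min_le_right _ _
        _ ≤ q := by linarith
    · -- walk branch: `L* = N²`, `√L* = N`
      rw [max_eq_left hle] at hkey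
      have hsqrtL : Real.sqrt ((2 : ℝ) ^ m * 2 ^ m) = 2 ^ m := Real.sqrt_mul_self hNpos.le
      rw [hsqrtL] at hkey
      have h1 : (hid m T : ℝ) ≤ 1152 * q := by
        nlinarith [hNpos, hkey]
      calc (1 / 4608 : ℝ) * min ((T : ℝ) + 1) s ≤ (1 / 4608) * (4 * (hid m T : ℝ)) := by
            gcongr
        _ ≤ q := by linarith
  · -- SMALL CASE `m ≤ 9`: `c · min ≤ √(2^9)/4608 < 1 ≤ Q`
    have hsqrt : Real.sqrt (2 ^ m) ≤ 32 := by
      rw [Real.sqrt_le_left (by norm_num)]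
      calc (2 : ℝ) ^ m ≤ 2 ^ 10 := pow_le_pow_right₀ (by norm_num) (by omega)
        _ = 32 ^ 2 := by norm_num
    calc (1 / 4608 : ℝ) * min ((T : ℝ) + 1) (Real.sqrt (2 ^ m)) ≤ (1 / 4608) * 32 := by
          gcongr
          exact (min_le_right _ _).trans hsqrt
      _ ≤ 1 := by norm_num
      _ ≤ _ := hQ1

/-- **The crux from the six stubs' TYPES** (transfer `C⁺ → crux`: dividing by `m ≥ 1` only weakens;
`Negative.crux_iff` is `Iff.rfl`). -/
theorem WbwVerifiableLineNoSpeedup_of_parts (hA : type_of% stub_relationalAdversary)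
    (hB : type_of% stub_pairProducts) (hP : type_of% stub_partnerFamily)
    (hG : type_of% stub_goodSetCard) (hN : type_of% stub_familyNonempty)
    (hD : type_of% stub_degrees) : WbwVerifiableLineNoSpeedup := by
  rw [crux_iff]
  refine ⟨1 / 4608, by norm_num, fun m T hm hT hTm => ?_⟩
  have hm1 : (1 : ℝ) ≤ m := by exact_mod_cast le_trans (by norm_num) hm
  have key := cruxShape_of_parts hA hB (hD hP hG hN) m T hm hT hTm
  have hnn : 0 ≤ (1 / 4608 : ℝ) * min ((T : ℝ) + 1) (Real.sqrt (2 ^ m)) :=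
    mul_nonneg (by norm_num) (le_min (by positivity) (Real.sqrt_nonneg _))
  exact (div_le_self hnn hm1).trans key

/-- **COMPOSITION (kernel-checked modulo the registered stubs): the crux BY NAME.** -/
theorem WbwVerifiableLineNoSpeedup_of :
    Summit.QuantumAdvantage.QuantumAdvantage.Theses.WhiteBoxWalk.WbwVerifiableLineNoSpeedup :=
  WbwVerifiableLineNoSpeedup_of_parts stub_relationalAdversary stub_pairProducts stub_partnerFamily
    stub_goodSetCard stub_familyNonempty stub_degrees

end Composition

end Summit.QuantumAdvantage.QuantumAdvantage.Theorems.WbwVerifiableLineNoSpeedup.CycleSurgery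

end
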